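import Summits.HubbardSuperconductivity.HubbardLadder.NeelSignPatternC23E
import Summits.HubbardSuperconductivity.HubbardLadder.NeelRPCeilingCorrelationRowsEightA
import Summits.HubbardSuperconductivity.HubbardLadder.NeelRPCeilingCorrelationRowsTenA
import Summits.HubbardSuperconductivity.HubbardLadder.NeelRPCorrelationWindowRowsTwelveFdc
import HarnessLib

/-!
# The Néel sign at (2,3) on EVERY even torus from 8 × 8 on — display corollary of device D52 (r2 g27)

HONEST FRAMING: ladder R1–R4 with certified numbers; no claim on H/H₀.  Reference model: the spin-½ Heisenberg
antiferromagnet on the even torus `(ℤ/2kℤ)²`; a WEAK, uniform short-distance SIGN statement — not Néel order, not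
the Hubbard model, nothing about `L → ∞` beyond the stated inequality.

`heisRedCorr2_C23_ceiling_all (k) (hk : 4 ≤ k) : c_{2k}(2,3) ≤ -3/5000` glues the L-uniform kernel theorem
`heisRedCorr2_C23_ceiling` (every even `L ≥ 14`, LEAN FILING REQUEST #242.34) to the three landed finite-torus rows
`heisRedCorr2_eight_2_3_le` (`c_8(2,3) ≤ -0.0022`, #240.1), `heisRedCorr2_ten_2_3_le` (`c_10(2,3) ≤ -0.0029`, #240.2) and
`heisRedCorr2_twelve_2_3_le` (`c_12(2,3) ≤ -0.0020`, #233), all UNCONDITIONAL (energy input = the tree theorem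
`Bounds.heisTL_fdc_upper_2x2`).  Display form, +0 for the tally; the 6 × 6 row `heisRedCorr2_six_2_3_le_of_groundEnergy_le`
stays conditional on `[H₆]` and is not used.
-/

noncomputable section

open Literature.MathematicalPhysics.QuantumLattice

namespace Summit.HubbardSuperconductivity.HubbardLadder

/-- For every even side `L = 2k ≥ 8` the reduced ground-state correlation of the spin-½ Heisenberg antiferromagnet on the
`L × L` torus at offset `(2,3)` satisfies `c_L(2,3) ≤ -3/5000` (strict Néel sign at graph distance 5, opposite sublattice;
Marshall–Lieb–Mattis gives only `≤ 0`).  Cases `k = 4, 5, 6` are the landed finite rows, `k ≥ 7` is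
`heisRedCorr2_C23_ceiling`.  HONEST FRAMING: ladder R1–R4 with certified numbers; no claim on H/H₀. -/
theorem heisRedCorr2_C23_ceiling_all (k : ℕ) (hk : 4 ≤ k) :
    haveI : NeZero (2 * k) := ⟨by omega⟩
    heisRedCorr2 (2 * k) 1 2 3 ≤ (-3/5000 : ℝ) := by
  rcases Nat.lt_or_ge k 7 with h7 | h7
  · interval_cases k
    · have h := heisRedCorr2_eight_2_3_le
      exact le_trans h (by norm_num)
    · have h := heisRedCorr2_ten_2_3_le
      exact le_trans h (by norm_num)
    · have h := heisRedCorr2_twelve_2_3_le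
      exact le_trans h (by norm_num)
  · exact heisRedCorr2_C23_ceiling k h7

end Summit.HubbardSuperconductivity.HubbardLadder

end
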